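import Literature.Computability.Cryptography.QuantumCircuit
import Mathlib.Algebra.BigOperators.Fin
import Mathlib.Analysis.Complex.Basic
import HarnessLib

/-!
# Register path sums: amplitudes and Born weights of a gate-list circuit as sums over computational-basis paths

The elementary "sum over paths" form of the matrix semantics of Q2's circuits
(`Literature.Computability.Cryptography.QCircuit`: a list of placed gates, first gate acting
first, `toMatrix A C = (C.gates.map (toMatrix A)).reverse.prod`): the amplitude
`⟨y| U_T ⋯ U_1 |z₀⟩` is the sum, over all register paths `π : Fin (T+1) → QReg N` from `z₀` to
`y`, of the products of the gate entries `(U_t)_{π(t), π(t-1)}`, and a Born weight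
`Σ_y obs(y) |⟨y|U|z₀⟩|²` is the corresponding double sum over a path and a conjugate path that
start at `z₀` and end together. This is the starting point of every tensor-network / sum-of-
products treatment of circuit simulation (Markov–Shi 2008, Prop. 3.5: contracting the network
`N(C; x, τ)` gives the probability that the measurement scenario `τ` is realised; here `τ` is a
product of diagonal one-wire effects `obs w : Bool → ℂ`, e.g. "wire `0` reads `1`", all other
wires traced out).

* `regPathWeight A gs π = ∏_t (gs[t]).toMatrix A (π (t+1)) (π t)`; `regPathWeight_cons`.
* `toMatrix_apply_eq_sum_regPathWeight` — `(⟨gs⟩.toMatrix A) y z₀ = Σ_π [π 0 = z₀] [π T = y] regPathWeight π`.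
* `obsWeight obs y = ∏_w obs w (y w)`, `bornSum A gs z₀ obs = Σ_y obsWeight y · ψ(y) · conj ψ(y)`
  with `ψ = ⟨gs⟩.runOn A |z₀⟩`; `bornSum_eq_sum_regPathWeight` — the double path sum.
* `acceptProb_eq_bornSum` — Q2's acceptance probability (wire `0` reads `1` on input
  `|x⟩|0^m⟩`) is the Born sum for the indicator effect on wire `0`.

## References

* [MarkovShi2008] I. L. Markov, Y. Shi, *Simulating quantum computation by contracting tensor
  networks*, SIAM J. Comput. 38 (2008) 963–981, §3 (Prop. 3.5 and its proof: "sequentially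
  contracting input wires of `g_1, ⋯, g_t` gives the tensor for `ρ^t`", p. 8 of
  arXiv:quant-ph/0511069). Read via `lit read paper:arxiv-quant-ph_0511069`.
* M. A. Nielsen, I. L. Chuang, *Quantum Computation and Quantum Information*, CUP 2010, §4.2
  (matrix of a circuit), §2.2.5 (Born rule).
-/

noncomputable section

namespace Literature.Computability.QuantumComplexity

open _root_.Computability Cryptography Matrix

variable {G : QGateSet} {N : ℕ}

/-! ### Path weights and the amplitude path sum -/

/-- The **weight of a register path** `π : Fin (T+1) → QReg N` through the gate list `gs`
(`T = |gs|`, head acting first) relative to the oracle `A`: the product over the gates of the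
entries `(U_t)_{π(t+1), π(t)}`. [cite: MarkovShi2008, §3 (proof of Prop 3.5)] -/
def regPathWeight (A : Language Bool) (gs : List (QGate G N)) (π : Fin (gs.length + 1) → QReg N) : ℂ :=
  ∏ t : Fin gs.length, (gs[(t : ℕ)]).toMatrix A (π t.succ) (π t.castSucc)

/-- The empty gate list has a single path of weight `1` per register state. [folklore] -/
@[simp] theorem regPathWeight_nil (A : Language Bool) (π : Fin 1 → QReg N) :
    regPathWeight A ([] : List (QGate G N)) π = 1 := by
  simp [regPathWeight]

/-- Prepending a gate: the path `x, π(0), π(1), …` weighs `(U_g)_{π 0, x}` times the weight of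
`π` through the remaining gates. [folklore] -/
theorem regPathWeight_cons (A : Language Bool) (g : QGate G N) (gs : List (QGate G N)) (x : QReg N)
    (π : Fin (gs.length + 1) → QReg N) :
    regPathWeight A (g :: gs) (Fin.cons x π : Fin (gs.length + 1 + 1) → QReg N) =
      g.toMatrix A (π 0) x * regPathWeight A gs π := by
  unfold regPathWeight
  show ∏ t : Fin (gs.length + 1), (g :: gs)[(t : ℕ)].toMatrix A
      ((Fin.cons x π : Fin (gs.length + 1 + 1) → QReg N) t.succ)
      ((Fin.cons x π : Fin (gs.length + 1 + 1) → QReg N) t.castSucc) = _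
  rw [Fin.prod_univ_succ]
  rfl

/-- **Amplitudes are path sums**: the `(y, z₀)` entry of the matrix of the gate list `gs` is the
sum over register paths from `z₀` to `y` of their weights,
`⟨y| U_T ⋯ U_1 |z₀⟩ = Σ_{π : π 0 = z₀, π T = y} ∏_t (U_t)_{π(t+1), π(t)}` (iterated matrix
multiplication; the input and output constraints are written as indicator factors, as in a
tensor network with input and output tensors attached). [cite: MarkovShi2008, §3 (Prop 3.5)] -/
theorem toMatrix_apply_eq_sum_regPathWeight (A : Language Bool) (gs : List (QGate G N))
    (y z₀ : QReg N) :
    (⟨gs⟩ : QCircuit G N).toMatrix A y z₀ =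
      ∑ π : Fin (gs.length + 1) → QReg N,
        if π 0 = z₀ ∧ π (Fin.last _) = y then regPathWeight A gs π else 0 := by
  induction gs generalizing z₀ with
  | nil =>
    rw [QCircuit.toMatrix_nil, Matrix.one_apply]
    show _ = ∑ π : Fin (0 + 1) → QReg N,
        if π 0 = z₀ ∧ π (Fin.last 0) = y then regPathWeight A ([] : List (QGate G N)) π else 0
    rw [← (Equiv.funUnique (Fin 1) (QReg N)).symm.sum_comp]
    simp only [Equiv.funUnique_symm_apply, regPathWeight_nil]
    have : ∀ x : QReg N, (uniqueElim (α := fun _ : Fin 1 => QReg N) x : Fin 1 → QReg N) 0 = x :=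
      fun x => rfl
    simp only [Fin.last_zero, this, ite_and]
    rw [Finset.sum_ite_eq' Finset.univ z₀]
    simp [eq_comm]
  | cons g gs ih =>
    rw [QCircuit.toMatrix_cons, Matrix.mul_apply]
    show _ = ∑ π : Fin (gs.length + 1 + 1) → QReg N,
        if π 0 = z₀ ∧ π (Fin.last (gs.length + 1)) = y then regPathWeight A (g :: gs) π else 0
    simp_rw [ih]
    -- left: Σ_z (Σ_π [π 0 = z ∧ π T = y] w π) · (U_g)_{z, z₀}
    have hL : ∀ z : QReg N,
        (∑ π : Fin (gs.length + 1) → QReg N,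
            if π 0 = z ∧ π (Fin.last _) = y then regPathWeight A gs π else 0) * g.toMatrix A z z₀ =
          ∑ π : Fin (gs.length + 1) → QReg N,
            if π 0 = z ∧ π (Fin.last _) = y then regPathWeight A gs π * g.toMatrix A z z₀ else 0 := by
      intro z
      rw [Finset.sum_mul]
      exact Finset.sum_congr rfl fun π _ => by split_ifs <;> simp
    simp_rw [hL]
    rw [Finset.sum_comm]
    have hz : ∀ π : Fin (gs.length + 1) → QReg N,
        (∑ z : QReg N,
            if π 0 = z ∧ π (Fin.last _) = y then regPathWeight A gs π * g.toMatrix A z z₀ else 0) =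
          if π (Fin.last _) = y then regPathWeight A gs π * g.toMatrix A (π 0) z₀ else 0 := by
      intro π
      simp only [ite_and]
      rw [Finset.sum_ite_eq Finset.univ (π 0)]
      simp
    simp_rw [hz]
    -- right: reindex paths of length `T + 2` as `Fin.cons x π`
    rw [← (Fin.consEquiv fun _ : Fin (gs.length + 1 + 1) => QReg N).sum_comp,
      Fintype.sum_prod_type, Finset.sum_comm]
    refine Finset.sum_congr rfl fun π _ => ?_
    simp only [Fin.consEquiv_apply, Fin.cons_zero]
    have hlast : ∀ x : QReg N,
        (Fin.cons x π : Fin (gs.length + 1 + 1) → QReg N) (Fin.last (gs.length + 1)) =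
          π (Fin.last gs.length) := fun x => by
      rw [← Fin.succ_last, Fin.cons_succ]
    simp only [hlast, ite_and]
    rw [Finset.sum_ite_eq' Finset.univ z₀]
    simp only [Finset.mem_univ, if_true]
    split_ifs
    · show _ = regPathWeight A (g :: gs) (Fin.cons z₀ π)
      rw [regPathWeight_cons, mul_comm]
    · rfl

/-- The state reached from a basis state: `(U |z₀⟩)(y) = U_{y, z₀}`. [folklore] -/
theorem runOn_basisState_apply (A : Language Bool) (C : QCircuit G N) (z₀ y : QReg N) :
    C.runOn A (basisState z₀) y = C.toMatrix A y z₀ := by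
  simp [QCircuit.runOn, basisState]

/-! ### Born weights -/

/-- The weight of an output string under diagonal one-wire effects `obs w : Bool → ℂ`:
`∏_w obs w (y w)` (e.g. the indicator of "wire `0` reads `1`": `obs 0 = [· = true]`,
`obs w = 1` otherwise — a measurement scenario with all other wires traced out).
[cite: MarkovShi2008, §3 (Def 3.4, measurement scenarios)] -/
def obsWeight (obs : Fin N → Bool → ℂ) (y : QReg N) : ℂ := ∏ w, obs w (y w)

/-- **The Born sum** of the gate list `gs` on the basis input `z₀` for the effects `obs`:
`Σ_y obsWeight y · ψ(y) · conj ψ(y)`, `ψ = U_T ⋯ U_1 |z₀⟩`. For a unitary gate set and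
`{0,1}`-valued `obs` this is the probability of the corresponding event.
[cite: MarkovShi2008, §3 (Prop 3.5)] -/
def bornSum (A : Language Bool) (gs : List (QGate G N)) (z₀ : QReg N) (obs : Fin N → Bool → ℂ) : ℂ :=
  ∑ y, obsWeight obs y *
    ((⟨gs⟩ : QCircuit G N).runOn A (basisState z₀) y *
      (starRingEnd ℂ) ((⟨gs⟩ : QCircuit G N).runOn A (basisState z₀) y))

/-- **Born weights are double path sums**: `bornSum = Σ_{π, π'} [π 0 = z₀] [π' 0 = z₀]
[π T = π' T] · obsWeight (π T) · w(π) · conj w(π')` — a path and a conjugate path from `z₀`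
that end in the same output string (the tensor network `N(C; x, τ)` of Markov–Shi with input
tensors `|z₀⟩⟨z₀|` and diagonal output effects, written over the doubled register).
[cite: MarkovShi2008, §3 (Prop 3.5)] -/
theorem bornSum_eq_sum_regPathWeight (A : Language Bool) (gs : List (QGate G N)) (z₀ : QReg N)
    (obs : Fin N → Bool → ℂ) :
    bornSum A gs z₀ obs =
      ∑ π : Fin (gs.length + 1) → QReg N, ∑ π' : Fin (gs.length + 1) → QReg N,
        if π 0 = z₀ ∧ π' 0 = z₀ ∧ π (Fin.last _) = π' (Fin.last _) then
          obsWeight obs (π (Fin.last _)) * (regPathWeight A gs π * (starRingEnd ℂ) (regPathWeight A gs π'))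
        else 0 := by
  unfold bornSum
  simp_rw [runOn_basisState_apply, toMatrix_apply_eq_sum_regPathWeight, map_sum, Finset.sum_mul_sum,
    Finset.mul_sum]
  -- Σ_y Σ_π Σ_π' obs(y) ([..y] w π · conj([..y] w π')) = Σ_π Σ_π' Σ_y …
  rw [Finset.sum_comm]
  refine Finset.sum_congr rfl fun π _ => ?_
  rw [Finset.sum_comm]
  refine Finset.sum_congr rfl fun π' _ => ?_
  have key : ∀ y : QReg N,
      obsWeight obs y * ((if π 0 = z₀ ∧ π (Fin.last _) = y then regPathWeight A gs π else 0) *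
        (starRingEnd ℂ) (if π' 0 = z₀ ∧ π' (Fin.last _) = y then regPathWeight A gs π' else 0)) =
      if π (Fin.last _) = y then
        (if π 0 = z₀ ∧ π' 0 = z₀ ∧ π (Fin.last _) = π' (Fin.last _) then
          obsWeight obs (π (Fin.last _)) * (regPathWeight A gs π * (starRingEnd ℂ) (regPathWeight A gs π'))
        else 0)
      else 0 := by
    intro y
    by_cases h1 : π (Fin.last _) = y
    · subst h1
      by_cases h2 : π 0 = z₀ <;> by_cases h3 : π' 0 = z₀ <;>
        by_cases h4 : π (Fin.last _) = π' (Fin.last _) <;> simp [h2, h3, h4, eq_comm]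
    · simp [h1]
  simp_rw [key]
  rw [Finset.sum_ite_eq Finset.univ (π (Fin.last _))]
  simp

/-- **Q2's acceptance probability is a Born sum**: for a circuit on `n + m` wires run on
`|x⟩|0^m⟩`, the probability that wire `0` reads `1` is the Born sum for the indicator effect on
wire `0` (all other wires traced out), as a complex number. [cite: MarkovShi2008, §3 (Prop 3.5)] -/
theorem acceptProb_eq_bornSum {n m : ℕ} (A : Language Bool) (C : QCircuit G (n + m)) (x : QReg n)
    (h : 0 < n + m) :
    (C.acceptProb A x : ℂ) =
      bornSum A C.gates (padInput x m)
        (fun w b => if w = ⟨0, h⟩ then (if b then 1 else 0) else 1) := by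
  unfold QCircuit.acceptProb bornSum obsWeight
  rw [Complex.ofReal_sum]
  refine Finset.sum_congr rfl fun y _ => ?_
  rw [dif_pos h, Finset.prod_ite_eq']
  simp only [Finset.mem_univ, if_true]
  have hC : (⟨C.gates⟩ : QCircuit G (n + m)) = C := rfl
  rw [hC, Complex.mul_conj, Complex.normSq_eq_norm_sq]
  split_ifs <;> simp

end Literature.Computability.QuantumComplexity

end
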